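import Literature.AlgebraicGeometry.Resolution.WeightedCentreShiftLine
import Literature.AlgebraicGeometry.Resolution.WeightedCentreCharacterProjection
import Literature.AlgebraicGeometry.Resolution.WeightedCentreLemmaL
import HarnessLib

/-!
# THEOREM RZ, first half: a rigid fixing shift is `σP₁ + σ^p P_p`, and it vanishes when `P_p = 0`
# (instrument for engine 1's `W(f)` toy model, NOT a resolution theorem)

Engine 1 of the RESOLUTION OBSERVATORY toy model `W(f)` (RE-DERIVATION-eng1-g41 §3.7.4 THEOREM RZ; CARVER-NOTES-eng1-g42 T92).
A RIGID `Z`-infinitesimal isotropy, written additively, is a fixing shift `P = (P_x)_x ∈ AdditiveShift.fixingShifts U G`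
(`WeightedCentreAdditiveShifts`: `G((ε_x + P_x(σ, ε_U))_x) = G(ε)`, `P = 0` on `U ⊇ Z`) whose blocks `P_{x,s} := [σ^s] P_x` are
polynomials in the parameter slots `ε_Z` only, of total weight `w_x` (`IsTW w ρ₁ (w x) (P x)`: the block `P_{x,s}` is a `w`-form of
weight `w_x − sρ₁`), with `σ`-orders `1 ≤ s ≤ p`.  THEOREM RZ says `P = 0`; its proof runs: LEMMA C (characters of `𝔽_p^×`,
`WeightedCentreCharacterProjection`) makes every `σ^r`-part `σ^r P_r`, `2 ≤ r ≤ p − 1`, a fixing shift; a `σ^r`-monomial fixing shift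
IS a line of translations fixing `G` (`WeightedCentreShiftLine`, `σ` the free parameter); LEMMA L (`WeightedCentreLemmaL`) kills such
a line under the class pins of (P).  Hence `P = σP₁ + σ^p P_p`; and if `P_p = 0` the same argument at `r = 1` gives `P = 0`.
What is typed here (all slots FINITE, `k` a field of characteristic `p`, weights in any linearly ordered group, pins as
`InvariantDirection.ClassPinned` hypotheses exactly as in `WeightedCentreIRigid`):
* `RZReduction.eq_zero_of_monomial_mem_fixingShifts` — LEMMA L for a `σ^r`-monomial fixing shift `(P_x(ε_Z)·σ^r)_x`, `r ≥ 1`;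
* `RZReduction.coeff_eq_zero_of_mem_fixingShifts` — the middle blocks vanish: `P_r = 0` for `2 ≤ r ≤ p − 1`;
* `RZReduction.eq_zero_of_coeff_p_eq_zero` — if the top block `P_p` vanishes then `P = 0`;
* `RZReduction.shape_of_ne_zero` — THEOREM RZ reduced to its endgame: a non-zero rigid fixing shift is `σP₁ + σ^pP_p` with `P_p ≠ 0`
  (the `(E_N)` analysis of `WeightedCentreRZEndgame` / `WeightedCentreMonomialCurve` then takes over).
The hypotheses: `Z` lighter than every slot outside `Z` (an initial segment), all weights positive, every moved slot's class pinned in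
its face `killLight {w ≥ w_x} G` (`WeightedCentreHeavyTaylor`, `WeightedCentreClassLinearPin`).

References: Taylor expansion along a line and algebraic independence [Lang2002, Ch. IV §1, Ch. XIII §4]; characters of a finite cyclic
group [Lang2002, Ch. V §5; SerreLocalFields1979, Ch. II §4 Lemma 1]; the weighted frame [AbramovichTemkinWlodarczyk2024, §5.1 (p. 1575),
Thm. 5.3.1].  All statements are OURS (toy-model bookkeeping) — instruments for engine 1's `W(f)` model, NOT resolution theorems.
-/

namespace Literature.AlgebraicGeometry.Resolution.WeightedBlowup

open Polynomial

namespace RZReduction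

variable {k : Type*} [Field k] {ι : Type*} [Fintype ι] [DecidableEq ι]
  {M : Type*} [AddCommGroup M] [LinearOrder M] [IsOrderedAddMonoid M]

omit [Fintype ι] [DecidableEq ι] [LinearOrder M] [IsOrderedAddMonoid M] in
/-- Weighted homogeneity only sees the weights of the occurring variables (ours, bookkeeping). [cite: Lang2002, Ch. IV §1] -/
theorem isWeightedHomogeneous_of_eqOn_vars {w ω : ι → M} {f : MvPolynomial ι k} (h : ∀ i ∈ f.vars, ω i = w i) {n : M}
    (hf : MvPolynomial.IsWeightedHomogeneous w f n) : MvPolynomial.IsWeightedHomogeneous ω f n := by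
  intro m hm
  rw [← hf hm, Finsupp.weight_apply, Finsupp.weight_apply, Finsupp.sum, Finsupp.sum]
  refine Finset.sum_congr rfl fun i hi => ?_
  rw [h i ((MvPolynomial.mem_vars_iff_mem_support i).mpr ⟨m, MvPolynomial.mem_support_iff.mpr hm, hi⟩)]

/-- **LEMMA L for a `σ^r`-monomial fixing shift** (ours; RE-DERIVATION-eng1-g41 §3.7.3): let `Z` be a finite set of PARAMETER slots
lighter than every other slot, all weights positive, and `v = (v_x)_x` a rigid direction field — `v_x ∈ k[ε_Z]` a `w`-form of weight
`w_x − rρ₁`, `v = 0` on `Z` — such that the class of every moved slot is pinned in its face.  If `(v_x · σ^r)_x` (`r ≥ 1`) is a fixing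
shift of `G`, then `v = 0`.  Proof: the fixing shift IS the line `G(ε + t·v) = G(ε)` (`AdditiveShift.isIsotropyOf_iff_polyShift_eq_C`),
and `LemmaL.eq_zero_of_classPinned` with the `Z`-weight `ω := w·𝟙_Z`.
[cite: Lang2002, Ch. IV §1, Ch. XIII §4; AbramovichTemkinWlodarczyk2024, §5.1 (p. 1575), Thm. 5.3.1] -/
theorem eq_zero_of_monomial_mem_fixingShifts {U : Set ι} {G : MvPolynomial ι k} (Z : Finset ι)
    (w : ι → M) (hw : ∀ i, 0 < w i) (ρ₁ : M) (hZlt : ∀ i ∈ Z, ∀ x, x ∉ Z → w i < w x)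
    {v : ι → MvPolynomial ι k} (hvZ : ∀ x, ∀ i ∈ (v x).vars, i ∈ Z) (hv0 : ∀ i ∈ Z, v i = 0)
    {r : ℕ} (hr : 0 < r) (hhom : ∀ x, MvPolynomial.IsWeightedHomogeneous w (v x) (w x - r • ρ₁))
    (hPin : ∀ x, v x ≠ 0 →
      InvariantDirection.ClassPinned (Finset.univ.filter fun i => w i = w x) (killLight (fun i => w x ≤ w i) G) x)
    (hmem : (fun x => C (v x) * X ^ r) ∈ AdditiveShift.fixingShifts U G) : v = 0 := by
  classical
  have h : PolyShift.polyShift v G = Polynomial.C G :=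
    (AdditiveShift.isIsotropyOf_iff_polyShift_eq_C hr).mp (AdditiveShift.mem_fixingShifts_iff.mp hmem).2.2
  let ω : ι → M := fun i => if i ∈ Z then w i else 0
  have hωZ : ∀ i, 0 < ω i ↔ i ∈ Z := fun i => by
    by_cases hi : i ∈ Z <;> simp [ω, hi, hw i]
  refine LemmaL.eq_zero_of_classPinned w ω (fun i => ?_) v (fun x => w x - r • ρ₁)
    (fun x i hi => (hωZ i).mpr (hvZ x i hi)) (fun j hj => hv0 j ((hωZ j).mp hj)) (fun x => ?_) (fun x x' _ _ hδ => ?_)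
    (fun x i hx hi => ?_) hPin h
  · by_cases hi : i ∈ Z <;> simp [ω, hi, (hw i).le]
  · exact isWeightedHomogeneous_of_eqOn_vars (fun i hi => by simp [ω, hvZ x i hi]) (hhom x)
  · exact sub_left_inj.mp hδ
  · exact hZlt i ((hωZ i).mp hi) x fun hxZ => hx (hv0 x hxZ)

/-- **THEOREM RZ, the middle blocks** (ours; RE-DERIVATION-eng1-g41 §3.7.4, first sentence of the proof): a rigid fixing shift
`P = Σ_{s=1}^{p} σ^s P_s` of `G` (field of characteristic `p`; `P = 0` on `U ⊇ Z`, blocks in `k[ε_Z]` of total weight `w_x`, `Z`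
lighter than every other slot, moved classes pinned in their faces) has `P_r = 0` for `2 ≤ r ≤ p − 1` — LEMMA C
(`AdditiveShift.coeffPart_mem_fixingShifts`) then LEMMA L (`eq_zero_of_monomial_mem_fixingShifts`).
[cite: Lang2002, Ch. V §5, Ch. IV §1; SerreLocalFields1979, Ch. II §4 Lemma 1; AbramovichTemkinWlodarczyk2024, §5.1 (p. 1575)] -/
theorem coeff_eq_zero_of_mem_fixingShifts (p : ℕ) [Fact p.Prime] [CharP k p] {U : Set ι} {G : MvPolynomial ι k}
    {P : ι → (MvPolynomial ι k)[X]} (hPG : P ∈ AdditiveShift.fixingShifts U G) (hdeg : ∀ x, (P x).natDegree ≤ p)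
    (h0 : ∀ x, (P x).coeff 0 = 0)
    (Z : Finset ι) (hZU : ∀ i ∈ Z, i ∈ U) (w : ι → M) (hw : ∀ i, 0 < w i) (ρ₁ : M)
    (hZlt : ∀ i ∈ Z, ∀ x, x ∉ Z → w i < w x) (hrigid : ∀ x s, ∀ i ∈ ((P x).coeff s).vars, i ∈ Z)
    (hTW : ∀ x, IsTW w ρ₁ (w x) (P x))
    (hPin : ∀ x, P x ≠ 0 →
      InvariantDirection.ClassPinned (Finset.univ.filter fun i => w i = w x) (killLight (fun i => w x ≤ w i) G) x)
    {r : ℕ} (h2r : 2 ≤ r) (hrp : r ≤ p - 1) (x : ι) : (P x).coeff r = 0 := by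
  have hmem := AdditiveShift.coeffPart_mem_fixingShifts p hPG hdeg h0 h2r hrp
  have hv := eq_zero_of_monomial_mem_fixingShifts Z w hw ρ₁ hZlt (v := fun x => (P x).coeff r) (fun x => hrigid x r)
    (fun i hi => by simp only [(AdditiveShift.mem_fixingShifts_iff.mp hPG).1 i (hZU i hi), coeff_zero])
    (lt_of_lt_of_le two_pos h2r) (fun x => hTW x r) (fun x hx => hPin x fun hP => hx (by simp only [hP, coeff_zero])) hmem
  exact congrFun hv x

/-- **THEOREM RZ, the case `P_p = 0`** (ours; RE-DERIVATION-eng1-g41 §3.7.4: "if `P_p = 0` then `P = σP₁ ≠ 0` … a line, LEMMA L,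
contradiction"): in the setting of `coeff_eq_zero_of_mem_fixingShifts`, if the top block `P_p` vanishes then `P = 0`.
[cite: Lang2002, Ch. V §5, Ch. IV §1, Ch. XIII §4; SerreLocalFields1979, Ch. II §4 Lemma 1; AbramovichTemkinWlodarczyk2024, §5.1 (p. 1575)] -/
theorem eq_zero_of_coeff_p_eq_zero (p : ℕ) [Fact p.Prime] [CharP k p] {U : Set ι} {G : MvPolynomial ι k}
    {P : ι → (MvPolynomial ι k)[X]} (hPG : P ∈ AdditiveShift.fixingShifts U G) (hdeg : ∀ x, (P x).natDegree ≤ p)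
    (h0 : ∀ x, (P x).coeff 0 = 0)
    (Z : Finset ι) (hZU : ∀ i ∈ Z, i ∈ U) (w : ι → M) (hw : ∀ i, 0 < w i) (ρ₁ : M)
    (hZlt : ∀ i ∈ Z, ∀ x, x ∉ Z → w i < w x) (hrigid : ∀ x s, ∀ i ∈ ((P x).coeff s).vars, i ∈ Z)
    (hTW : ∀ x, IsTW w ρ₁ (w x) (P x))
    (hPin : ∀ x, P x ≠ 0 →
      InvariantDirection.ClassPinned (Finset.univ.filter fun i => w i = w x) (killLight (fun i => w x ≤ w i) G) x)
    (hp : ∀ x, (P x).coeff p = 0) : P = 0 := by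
  have hmid : ∀ x r, 2 ≤ r → r ≤ p - 1 → (P x).coeff r = 0 := fun x r h2r hrp =>
    coeff_eq_zero_of_mem_fixingShifts p hPG hdeg h0 Z hZU w hw ρ₁ hZlt hrigid hTW hPin h2r hrp x
  have hshape : ∀ x, P x = C ((P x).coeff 1) * X ^ 1 := by
    intro x
    have e := AdditiveShift.eq_X_add_X_pow_of_coeff_eq_zero (P x) (Fact.out : p.Prime).two_le (hdeg x) (h0 x) (hmid x)
    rw [hp x, map_zero, zero_mul, add_zero] at e
    rw [pow_one]
    exact e
  have hfun : P = fun x => C ((P x).coeff 1) * X ^ 1 := funext hshape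
  have hv := eq_zero_of_monomial_mem_fixingShifts Z w hw ρ₁ hZlt (v := fun x => (P x).coeff 1) (fun x => hrigid x 1)
    (fun i hi => by simp only [(AdditiveShift.mem_fixingShifts_iff.mp hPG).1 i (hZU i hi), coeff_zero])
    one_pos (fun x => by simpa only [one_smul] using hTW x 1)
    (fun x hx => hPin x fun hP => hx (by simp only [hP, coeff_zero])) (hfun ▸ hPG)
  funext x
  have h1 : (P x).coeff 1 = 0 := congrFun hv x
  rw [hshape x, h1, map_zero, zero_mul]
  rfl

/-- **THEOREM RZ reduced to its endgame** (ours; RE-DERIVATION-eng1-g41 §3.7.4): a NON-ZERO rigid fixing shift in the setting above is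
`P = σ·P₁ + σ^p·P_p` with `P_p ≠ 0` somewhere — the input of the `(E_N)` analysis (`WeightedCentreRZEndgame`).
[cite: Lang2002, Ch. V §5, Ch. IV §1, Ch. XIII §4; SerreLocalFields1979, Ch. II §4 Lemma 1; AbramovichTemkinWlodarczyk2024, §5.1 (p. 1575)] -/
theorem shape_of_ne_zero (p : ℕ) [Fact p.Prime] [CharP k p] {U : Set ι} {G : MvPolynomial ι k}
    {P : ι → (MvPolynomial ι k)[X]} (hPG : P ∈ AdditiveShift.fixingShifts U G) (hdeg : ∀ x, (P x).natDegree ≤ p)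
    (h0 : ∀ x, (P x).coeff 0 = 0)
    (Z : Finset ι) (hZU : ∀ i ∈ Z, i ∈ U) (w : ι → M) (hw : ∀ i, 0 < w i) (ρ₁ : M)
    (hZlt : ∀ i ∈ Z, ∀ x, x ∉ Z → w i < w x) (hrigid : ∀ x s, ∀ i ∈ ((P x).coeff s).vars, i ∈ Z)
    (hTW : ∀ x, IsTW w ρ₁ (w x) (P x))
    (hPin : ∀ x, P x ≠ 0 →
      InvariantDirection.ClassPinned (Finset.univ.filter fun i => w i = w x) (killLight (fun i => w x ≤ w i) G) x)
    (hP : P ≠ 0) :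
    (∃ x, (P x).coeff p ≠ 0) ∧ ∀ x, P x = C ((P x).coeff 1) * X + C ((P x).coeff p) * X ^ p := by
  refine ⟨?_, fun x => AdditiveShift.eq_X_add_X_pow_of_coeff_eq_zero (P x) (Fact.out : p.Prime).two_le (hdeg x) (h0 x)
    fun r h2r hrp => coeff_eq_zero_of_mem_fixingShifts p hPG hdeg h0 Z hZU w hw ρ₁ hZlt hrigid hTW hPin h2r hrp x⟩
  by_contra hnone
  push Not at hnone
  exact hP (eq_zero_of_coeff_p_eq_zero p hPG hdeg h0 Z hZU w hw ρ₁ hZlt hrigid hTW hPin hnone)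

end RZReduction

end Literature.AlgebraicGeometry.Resolution.WeightedBlowup
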